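import Mathlib
import Summits.MatrixMultiplication.MatrixMultiplication.Theorems.SnSubsetDichotomyHyperoctahedralThresholdStubPatternTwin

/-!
# The twins ℓ² extraction, LOCAL form: any sub-family of twin pre-pairs
(crux `SnSubsetDichotomy.HyperoctahedralThreshold`, stmt-MatrixMultiplication-10883; siege seat k18, variation "twins ℓ² argument";
`--supports` helper, companion of `…TwinsEll2`)

Why a local form.  The global twin count of `stub_twinsEll2` (`ℓ·(2S₁ + 2RInc + Ξ) < Pairs`) is NOT satisfied by every poor rigid
host: a dense near-Cayley piece of size `≈ n^{3/4}/2` placed inside the forbidden set `R` carries almost all twin pre-pairs of every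
length (crux NOTES §C4 "an adversarial R sits on the dense vertices"), so `RInc ≈ Pairs` although the bulk is full of clean twins.
Any use of the twins count in the `R`-form must therefore LOCALISE the family of pre-pairs first (base points away from dense
vertices, after the sparse-cut surgery of `stub_sparseCutOGL`, …).  This file proves the extraction for an ARBITRARY finset `P'` of
twin pre-pairs of length `ℓ` (`hP'`: each `(z, x, y) ∈ P'` has `z` cyclically reduced of length `ℓ` and `x ≠ y` fixed by `z`):

`stub_twinsEll2Local`:  `#SELFx + #SELFy + #RHITx + #RHITy + #CROSS < |P'|`  ⇒  the conclusion of `stub_poorRigidCore` (with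
`k + 1 = ℓ` rungs), where the five incidence sets are taken INSIDE `P'`:
SELFx `= {((z,x,y),(s,t)) ∈ P' × [ℓ]² : s < t, x·z.take s = x·z.take t}`, SELFy the same for `y`,
RHITx `= {((z,x,y),t) ∈ P' × [ℓ] : x·z.take t ∈ R}`, RHITy the same for `y`,
CROSS `= {((z,x,y),(s,t)) ∈ P' × [ℓ]² : x·z.take s = y·z.take t}`.
(No symmetry of `P'` under `(x, y) ↦ (y, x)` is assumed, hence the two mirror terms.)  Proof as in `cleanData_of_incCount`; the
construction step is a private copy of `TwinsEll2.cleanData_of_goodPair` (module `…TwinsEll2`, p116079, not yet built on the farm at the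
time of writing — replace the copy by the import once it is).  Pure finite combinatorics; no hypothesis on `μ`; no definitions.
-/

set_option linter.dupNamespace false

namespace Summit.MatrixMultiplication.MatrixMultiplication.Theorems.HyperoctahedralThreshold

namespace TwinsEll2

open Finset

variable {n : ℕ}

/-- (Private copy of `TwinsEll2.cleanData_of_goodPair`.)  **Good pre-pair ⇒ clean data.**  If `x ≠ y` are fixed by the cyclically reduced `z` (`|z| ≥ 2`), both trajectories
are simple and avoid `R`, and they never cross (`x · z.take s ≠ y · z.take t`), then `p t := x · z.take t`,
`q t := y · z.take t`, `col t := z[t]` (`t : Fin (k+1)`, `k + 1 = |z|`) is clean closed-walk data in the format of the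
core's conclusion: distinct rung ends, side-preserving steps (`GoodTwin.foldl_take_step`), cyclically distinct
consecutive colours (`GoodTwin.cyclic_ne`), pairwise equal-or-disjoint rungs (equal iff same index), points outside `R`.
[construction of the landed `stub_patternTwin`, p107640] -/
private theorem cleanData_of_goodPair' (μ : Fin 3 → Equiv.Perm (Fin n)) (R : Finset (Fin n)) {z : List (Fin 3)}
    (hlen : 2 ≤ z.length) (hchain : List.IsChain (· ≠ ·) (z ++ z)) {x y : Fin n}
    (hx : z.foldl (fun v c => μ c v) x = x) (hy : z.foldl (fun v c => μ c v) y = y)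
    (hsx : ∀ s < z.length, ∀ t < z.length,
      (z.take s).foldl (fun v c => μ c v) x = (z.take t).foldl (fun v c => μ c v) x → s = t)
    (hsy : ∀ s < z.length, ∀ t < z.length,
      (z.take s).foldl (fun v c => μ c v) y = (z.take t).foldl (fun v c => μ c v) y → s = t)
    (hcross : ∀ s < z.length, ∀ t < z.length,
      (z.take s).foldl (fun v c => μ c v) x ≠ (z.take t).foldl (fun v c => μ c v) y)
    (hRx : ∀ t < z.length, (z.take t).foldl (fun v c => μ c v) x ∉ R)
    (hRy : ∀ t < z.length, (z.take t).foldl (fun v c => μ c v) y ∉ R) :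
    ∃ (k : ℕ) (p q : Fin (k + 1) → Fin n) (col : Fin (k + 1) → Fin 3), (∀ i, p i ≠ q i) ∧
      (∀ i, (μ (col i) (p i) = p (i + 1) ∧ μ (col i) (q i) = q (i + 1)) ∨
        (μ (col i) (p i) = q (i + 1) ∧ μ (col i) (q i) = p (i + 1))) ∧
      (∀ i, col i ≠ col (i + 1)) ∧
      (∀ i j, (p i = p j ∧ q i = q j) ∨ (p i = q j ∧ q i = p j) ∨
        (p i ≠ p j ∧ p i ≠ q j ∧ q i ≠ p j ∧ q i ≠ q j)) ∧
      (∀ i, p i ∉ R ∧ q i ∉ R) ∧ k + 1 = z.length := by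
  obtain ⟨k, hk⟩ : ∃ k, k + 1 = z.length := ⟨z.length - 1, by omega⟩
  have hlt : ∀ i : Fin (k + 1), (i : ℕ) < z.length := fun i => i.isLt.trans_eq hk
  have hval : ∀ i : Fin (k + 1), ((i + 1 : Fin (k + 1)) : ℕ) = ((i : ℕ) + 1) % z.length := fun i => by
    rw [PatternTwin.val_add_one]
    exact congrArg (fun N => ((i : ℕ) + 1) % N) hk
  refine ⟨k, fun i => (z.take i).foldl (fun v c => μ c v) x, fun i => (z.take i).foldl (fun v c => μ c v) y,
    fun i => z[(i : ℕ)]'(hlt i), ?_, ?_, ?_, ?_, ?_, hk⟩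
  · intro i
    exact hcross i (hlt i) i (hlt i)
  · intro i
    refine Or.inl ⟨?_, ?_⟩
    · show μ (z[(i : ℕ)]'(hlt i)) ((z.take i).foldl (fun v c => μ c v) x) =
        (z.take ((i + 1 : Fin (k + 1)) : ℕ)).foldl (fun v c => μ c v) x
      rw [hval i]
      exact GoodTwin.foldl_take_step μ z x hx i (hlt i)
    · show μ (z[(i : ℕ)]'(hlt i)) ((z.take i).foldl (fun v c => μ c v) y) =
        (z.take ((i + 1 : Fin (k + 1)) : ℕ)).foldl (fun v c => μ c v) y
      rw [hval i]
      exact GoodTwin.foldl_take_step μ z y hy i (hlt i)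
  · intro i
    exact GoodTwin.cyclic_ne hchain i _ (hlt i) (hlt (i + 1)) (hval i)
  · intro i j
    by_cases hij : i = j
    · subst hij
      exact Or.inl ⟨rfl, rfl⟩
    · have hij' : (i : ℕ) ≠ (j : ℕ) := fun h => hij (Fin.ext h)
      refine Or.inr (Or.inr ⟨fun h => hij' (hsx i (hlt i) j (hlt j) h), hcross i (hlt i) j (hlt j),
        fun h => hcross j (hlt j) i (hlt i) h.symm, fun h => hij' (hsy i (hlt i) j (hlt j) h)⟩)
  · intro i
    exact ⟨hRx i (hlt i), hRy i (hlt i)⟩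

/-- **Local twins ℓ² extraction.**  For any finset `P'` of twin pre-pairs of length `ℓ ≥ 2`, if the five incidence counts inside `P'`
(self-coincidences of `x`, of `y`, `R`-hits of `x`, of `y`, crossings) sum to less than `|P'|`, some member of `P'` is good and yields
clean closed-walk data with `ℓ` rungs avoiding `R`. -/
theorem cleanData_of_localCount (μ : Fin 3 → Equiv.Perm (Fin n)) (R : Finset (Fin n)) {ℓ : ℕ} (hℓ : 2 ≤ ℓ)
    (P' : Finset (List (Fin 3) × Fin n × Fin n))
    (hP' : ∀ t ∈ P', t.1.length = ℓ ∧ List.IsChain (· ≠ ·) (t.1 ++ t.1) ∧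
      t.1.foldl (fun v c => μ c v) t.2.1 = t.2.1 ∧ t.1.foldl (fun v c => μ c v) t.2.2 = t.2.2 ∧ t.2.1 ≠ t.2.2)
    (hcount : ((P' ×ˢ range ℓ ×ˢ range ℓ).filter (fun a => a.2.1 < a.2.2 ∧
          (a.1.1.take a.2.1).foldl (fun v c => μ c v) a.1.2.1 = (a.1.1.take a.2.2).foldl (fun v c => μ c v) a.1.2.1)).card +
      ((P' ×ˢ range ℓ ×ˢ range ℓ).filter (fun a => a.2.1 < a.2.2 ∧
          (a.1.1.take a.2.1).foldl (fun v c => μ c v) a.1.2.2 = (a.1.1.take a.2.2).foldl (fun v c => μ c v) a.1.2.2)).card +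
      ((P' ×ˢ range ℓ).filter (fun a => (a.1.1.take a.2).foldl (fun v c => μ c v) a.1.2.1 ∈ R)).card +
      ((P' ×ˢ range ℓ).filter (fun a => (a.1.1.take a.2).foldl (fun v c => μ c v) a.1.2.2 ∈ R)).card +
      ((P' ×ˢ range ℓ ×ˢ range ℓ).filter (fun a =>
          (a.1.1.take a.2.1).foldl (fun v c => μ c v) a.1.2.1 = (a.1.1.take a.2.2).foldl (fun v c => μ c v) a.1.2.2)).card <
      P'.card) :
    ∃ (k : ℕ) (p q : Fin (k + 1) → Fin n) (col : Fin (k + 1) → Fin 3), (∀ i, p i ≠ q i) ∧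
      (∀ i, (μ (col i) (p i) = p (i + 1) ∧ μ (col i) (q i) = q (i + 1)) ∨
        (μ (col i) (p i) = q (i + 1) ∧ μ (col i) (q i) = p (i + 1))) ∧
      (∀ i, col i ≠ col (i + 1)) ∧
      (∀ i j, (p i = p j ∧ q i = q j) ∨ (p i = q j ∧ q i = p j) ∨
        (p i ≠ p j ∧ p i ≠ q j ∧ q i ≠ p j ∧ q i ≠ q j)) ∧
      (∀ i, p i ∉ R ∧ q i ∉ R) ∧ k + 1 = ℓ := by
  classical
  -- the five kinds of bad members of `P'`
  set BSx := P'.filter (fun t => ∃ s < ℓ, ∃ s' < ℓ, s < s' ∧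
    (t.1.take s).foldl (fun v c => μ c v) t.2.1 = (t.1.take s').foldl (fun v c => μ c v) t.2.1) with hBSx
  set BSy := P'.filter (fun t => ∃ s < ℓ, ∃ s' < ℓ, s < s' ∧
    (t.1.take s).foldl (fun v c => μ c v) t.2.2 = (t.1.take s').foldl (fun v c => μ c v) t.2.2) with hBSy
  set BC := P'.filter (fun t => ∃ s < ℓ, ∃ s' < ℓ,
    (t.1.take s).foldl (fun v c => μ c v) t.2.1 = (t.1.take s').foldl (fun v c => μ c v) t.2.2) with hBC
  set BRx := P'.filter (fun t => ∃ s < ℓ, (t.1.take s).foldl (fun v c => μ c v) t.2.1 ∈ R) with hBRx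
  set BRy := P'.filter (fun t => ∃ s < ℓ, (t.1.take s).foldl (fun v c => μ c v) t.2.2 ∈ R) with hBRy
  -- the five incidence sets inside `P'`
  set ISx := (P' ×ˢ range ℓ ×ˢ range ℓ).filter (fun a => a.2.1 < a.2.2 ∧
    (a.1.1.take a.2.1).foldl (fun v c => μ c v) a.1.2.1 = (a.1.1.take a.2.2).foldl (fun v c => μ c v) a.1.2.1) with hISx
  set ISy := (P' ×ˢ range ℓ ×ˢ range ℓ).filter (fun a => a.2.1 < a.2.2 ∧
    (a.1.1.take a.2.1).foldl (fun v c => μ c v) a.1.2.2 = (a.1.1.take a.2.2).foldl (fun v c => μ c v) a.1.2.2) with hISy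
  set IRx := (P' ×ˢ range ℓ).filter (fun a => (a.1.1.take a.2).foldl (fun v c => μ c v) a.1.2.1 ∈ R) with hIRx
  set IRy := (P' ×ˢ range ℓ).filter (fun a => (a.1.1.take a.2).foldl (fun v c => μ c v) a.1.2.2 ∈ R) with hIRy
  set IC := (P' ×ˢ range ℓ ×ˢ range ℓ).filter (fun a =>
    (a.1.1.take a.2.1).foldl (fun v c => μ c v) a.1.2.1 = (a.1.1.take a.2.2).foldl (fun v c => μ c v) a.1.2.2) with hIC
  -- (1) bad members are covered by incidences (projection onto the first component)
  have h1 : BSx.card ≤ ISx.card := by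
    refine card_le_card_of_surjOn (fun a => a.1) ?_
    intro t h
    rw [mem_coe, hBSx, mem_filter] at h
    obtain ⟨ht, s, hs, s', hs', hss', hcoin⟩ := h
    refine ⟨(t, s, s'), ?_, rfl⟩
    rw [mem_coe, hISx, mem_filter]
    simp only [mem_product, mem_range]
    exact ⟨⟨ht, hs, hs'⟩, hss', hcoin⟩
  have h2 : BSy.card ≤ ISy.card := by
    refine card_le_card_of_surjOn (fun a => a.1) ?_
    intro t h
    rw [mem_coe, hBSy, mem_filter] at h
    obtain ⟨ht, s, hs, s', hs', hss', hcoin⟩ := h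
    refine ⟨(t, s, s'), ?_, rfl⟩
    rw [mem_coe, hISy, mem_filter]
    simp only [mem_product, mem_range]
    exact ⟨⟨ht, hs, hs'⟩, hss', hcoin⟩
  have h3 : BC.card ≤ IC.card := by
    refine card_le_card_of_surjOn (fun a => a.1) ?_
    intro t h
    rw [mem_coe, hBC, mem_filter] at h
    obtain ⟨ht, s, hs, s', hs', hcoin⟩ := h
    refine ⟨(t, s, s'), ?_, rfl⟩
    rw [mem_coe, hIC, mem_filter]
    simp only [mem_product, mem_range]
    exact ⟨⟨ht, hs, hs'⟩, hcoin⟩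
  have h4 : BRx.card ≤ IRx.card := by
    refine card_le_card_of_surjOn (fun a => a.1) ?_
    intro t h
    rw [mem_coe, hBRx, mem_filter] at h
    obtain ⟨ht, s, hs, hR⟩ := h
    refine ⟨(t, s), ?_, rfl⟩
    rw [mem_coe, hIRx, mem_filter]
    simp only [mem_product, mem_range]
    exact ⟨⟨ht, hs⟩, hR⟩
  have h5 : BRy.card ≤ IRy.card := by
    refine card_le_card_of_surjOn (fun a => a.1) ?_
    intro t h
    rw [mem_coe, hBRy, mem_filter] at h
    obtain ⟨ht, s, hs, hR⟩ := h
    refine ⟨(t, s), ?_, rfl⟩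
    rw [mem_coe, hIRy, mem_filter]
    simp only [mem_product, mem_range]
    exact ⟨⟨ht, hs⟩, hR⟩
  -- (2) hence some member of `P'` is in none of the five bad sets
  have hbad : (BSx ∪ BSy ∪ BC ∪ BRx ∪ BRy).card < P'.card := by
    have hc : ISx.card + ISy.card + IRx.card + IRy.card + IC.card < P'.card := hcount
    calc (BSx ∪ BSy ∪ BC ∪ BRx ∪ BRy).card
        ≤ BSx.card + BSy.card + BC.card + BRx.card + BRy.card := by
          refine (card_union_le _ _).trans (Nat.add_le_add_right ?_ _)
          refine (card_union_le _ _).trans (Nat.add_le_add_right ?_ _)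
          refine (card_union_le _ _).trans (Nat.add_le_add_right ?_ _)
          exact card_union_le _ _
      _ ≤ ISx.card + ISy.card + IC.card + IRx.card + IRy.card :=
          Nat.add_le_add (Nat.add_le_add (Nat.add_le_add (Nat.add_le_add h1 h2) h3) h4) h5
      _ < P'.card := by omega
  obtain ⟨⟨z, x, y⟩, hzP, hgood⟩ := exists_mem_notMem_of_card_lt_card hbad
  simp only [mem_union, not_or] at hgood
  obtain ⟨⟨⟨⟨hnSx, hnSy⟩, hnC⟩, hnRx⟩, hnRy⟩ := hgood
  obtain ⟨hzl, hchain, hx, hy, hxy⟩ := hP' _ hzP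
  dsimp only at hzl hchain hx hy hxy
  -- (3) unpack goodness
  have hsx : ∀ s < z.length, ∀ t < z.length,
      (z.take s).foldl (fun v c => μ c v) x = (z.take t).foldl (fun v c => μ c v) x → s = t := by
    intro s hs t ht h
    by_contra hst
    rcases Nat.lt_or_gt_of_ne hst with hlt | hlt
    · exact hnSx (by rw [hBSx, mem_filter]; exact ⟨hzP, s, by omega, t, by omega, hlt, h⟩)
    · exact hnSx (by rw [hBSx, mem_filter]; exact ⟨hzP, t, by omega, s, by omega, hlt, h.symm⟩)
  have hsy : ∀ s < z.length, ∀ t < z.length,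
      (z.take s).foldl (fun v c => μ c v) y = (z.take t).foldl (fun v c => μ c v) y → s = t := by
    intro s hs t ht h
    by_contra hst
    rcases Nat.lt_or_gt_of_ne hst with hlt | hlt
    · exact hnSy (by rw [hBSy, mem_filter]; exact ⟨hzP, s, by omega, t, by omega, hlt, h⟩)
    · exact hnSy (by rw [hBSy, mem_filter]; exact ⟨hzP, t, by omega, s, by omega, hlt, h.symm⟩)
  have hcross : ∀ s < z.length, ∀ t < z.length,
      (z.take s).foldl (fun v c => μ c v) x ≠ (z.take t).foldl (fun v c => μ c v) y := by
    intro s hs t ht h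
    exact hnC (by rw [hBC, mem_filter]; exact ⟨hzP, s, by omega, t, by omega, h⟩)
  have hRx : ∀ t < z.length, (z.take t).foldl (fun v c => μ c v) x ∉ R := by
    intro t ht h
    exact hnRx (by rw [hBRx, mem_filter]; exact ⟨hzP, t, by omega, h⟩)
  have hRy : ∀ t < z.length, (z.take t).foldl (fun v c => μ c v) y ∉ R := by
    intro t ht h
    exact hnRy (by rw [hBRy, mem_filter]; exact ⟨hzP, t, by omega, h⟩)
  -- (4) the construction
  obtain ⟨k, p, q, col, h₁, h₂, h₃, h₄, h₅, hk⟩ :=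
    cleanData_of_goodPair' μ R (by omega) hchain hx hy hsx hsy hcross hRx hRy
  exact ⟨k, p, q, col, h₁, h₂, h₃, h₄, h₅, hk.trans hzl⟩

/-- **`stub_twinsEll2Local` — the twins ℓ² extraction for an arbitrary family of pre-pairs** (registered `--supports` sub-goal of
crux stmt-MatrixMultiplication-10883): for a scale `2 ≤ ℓ ≤ n^{1/4}` and any finset `P'` of twin pre-pairs of length `ℓ`, if the five
incidence counts inside `P'` sum to less than `|P'|`, the conclusion of the open core `stub_poorRigidCore` holds verbatim. -/
theorem stub_twinsEll2Local : ∀ (n ℓ : ℕ) (μ : Fin 3 → Equiv.Perm (Fin n)) (R : Finset (Fin n)) (P' : Finset (List (Fin 3) × Fin n × Fin n)), 2 ≤ ℓ → (ℓ : ℝ) ≤ (n : ℝ) ^ ((1 : ℝ) / 4) → (∀ t ∈ P', t.1.length = ℓ ∧ List.IsChain (· ≠ ·) (t.1 ++ t.1) ∧ t.1.foldl (fun v c => μ c v) t.2.1 = t.2.1 ∧ t.1.foldl (fun v c => μ c v) t.2.2 = t.2.2 ∧ t.2.1 ≠ t.2.2) → ((P' ×ˢ Finset.range ℓ ×ˢ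 Finset.range ℓ).filter (fun a => a.2.1 < a.2.2 ∧ (a.1.1.take a.2.1).foldl (fun v c => μ c v) a.1.2.1 = (a.1.1.take a.2.2).foldl (fun v c => μ c v) a.1.2.1)).card + ((P' ×ˢ Finset.range ℓ ×ˢ Finset.range ℓ).filter (fun a => a.2.1 < a.2.2 ∧ (a.1.1.take a.2.1).foldl (fun v c => μ c v) a.1.2.2 = (a.1.1.take a.2.2).foldl (fun v c => μ c v) a.1.2.2)).card + ((P' ×ˢ Finset.range ℓ).filter (fun a => (a.1.1.take a.2).foldl (fun v c => μ c v) a.1.2.1 ∈ R)).card + ((P' ×ˢ Finset.range ℓ).filter (fun a => (a.1.1.take a.2).foldl (fun v c => μ c v) a.1.2.2 ∈ R)).card + ((P' ×ˢ Finset.range ℓ ×ˢ Finset.range ℓ).filter (fun a => (a.1.1.take a.2.1).foldl (fun v c => μ c v) a.1.2.1 = (a.1.1.take a.2.2).foldl (fun v c => μ c v) a.1.2.2)).card < P'.card → ∃ (k : ℕ) (p q : Fin (k + 1) → Fin n) (col : Fin (k + 1) → Fin 3), (∀ i, p i ≠ q i) ∧ (∀ i, (μ (col i) (p i) = p (i +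 1) ∧ μ (col i) (q i) = q (i + 1)) ∨ (μ (col i) (p i) = q (i + 1) ∧ μ (col i) (q i) = p (i + 1))) ∧ (∀ i, col i ≠ col (i + 1)) ∧ (∀ i j, (p i = p j ∧ q i = q j) ∨ (p i = q j ∧ q i = p j) ∨ (p i ≠ p j ∧ p i ≠ q j ∧ q i ≠ p j ∧ q i ≠ q j)) ∧ (∀ i, p i ∉ R ∧ q i ∉ R) ∧ ((k : ℝ) + 1) ≤ (n : ℝ) ^ ((1 : ℝ) / 4) := by
  intro n ℓ μ R P' hℓ hℓn hP' hcount
  obtain ⟨k, p, q, col, h1, h2, h3, h4, h5, hk⟩ := cleanData_of_localCount μ R hℓ P' hP' hcount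
  refine ⟨k, p, q, col, h1, h2, h3, h4, h5, ?_⟩
  have : ((k : ℝ) + 1) = (ℓ : ℝ) := by exact_mod_cast hk
  rw [this]
  exact hℓn

end TwinsEll2

end Summit.MatrixMultiplication.MatrixMultiplication.Theorems.HyperoctahedralThreshold
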